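import Mathlib
import Summits.QuantumFields.QCD.Theorems.QuarksAsStableActionUnquenchedChessboardBoundDilutedFloorSharp
import Summits.QuantumFields.QCD.Theorems.QuarksAsStableActionUnquenchedChessboardBoundHeavyFloor
import HarnessLib

/-!
# The floor from the peels, part 1: window bounds on diluted determinants (crux stmt-QuantumFields-9735, line `Sketch`)

Helper toward the lead's stub `stub_signedFloor` (reflection-positivity PEELING of the signed
partition function). This file turns the sharp pathwise bounds of `…DilutedFloorSharp` into
UNIFORM bounds on a mass window `[m_lo, m_hi] ⊂ (-1, ∞)` for bond sets supported in one or two time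
slices (the terminal and reference objects of the peeling), and sets up the diluted signed partition
function `Zb(E) = ∫ ∏_f det D_E[U, m_f] e^{-β S_W} ∏dU` as a real integral of a continuous function:

* `card_sliceSites`, `card_idx_mem`, `sliceBonds_support` — index counts of a time slice;
* `window_floor_re_det` — `(c₁/C₂)^{12|T|} (m+4)^{12L⁴} ≤ Re det D_E^{AP}(U, m)`,
  `window_ceiling_norm_det` — `|det D_E^{AP}(U, m)| ≤ (C₂/3)^{12|T|} (m+4)^{12L⁴}`
  (`c₁ = m_lo + 1`, `C₂ = |m_lo| + |m_hi| + 8`);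
* `continuous_det_bondWilsonDiracAP`, `signedZb_eq_ofReal` — `Zb(E) = ↑(∫ g_E)` with `g_E` continuous
  and integrable;
* `window_floor_prod`, `window_ceiling_prod` — the window bounds on `∏_f Re det D_E[U, m_f]`.

All statements are proved.
-/

noncomputable section

open Matrix Complex Finset
open Literature.MathematicalPhysics.QuantumFieldTheory Literature.MathematicalPhysics.QuantumLattice
open Literature.Probability.LatticeModels
open scoped ComplexConjugate BigOperators

namespace Summit.QuantumFields.QCD.Theorems.QuarksAsStableAction

/-! ## Floor assembly, part A: slice index counts, continuity, pathwise bounds -/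

section FloorA

variable {L : ℕ} [NeZero L]

/-- The sites of the time slice `t`. -/
def sliceSites (t : ZMod L) : Finset (TorusSite 4 L) := univ.filter fun x => x 0 = t

/-- Membership in `sliceSites`. -/
@[simp] theorem mem_sliceSites {t : ZMod L} {x : TorusSite 4 L} : x ∈ sliceSites t ↔ x 0 = t := by
  simp [sliceSites]

/-- A time slice has `L³` sites. -/
theorem card_sliceSites (t : ZMod L) : (sliceSites t).card = L ^ 3 := by
  have h : (sliceSites t).card = Fintype.card {x : TorusSite 4 L // x 0 = t} := by
    rw [Fintype.card_subtype]; rfl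
  rw [h]
  let e : {x : TorusSite 4 L // x 0 = t} ≃ (Fin 3 → ZMod L) :=
    { toFun := fun x => Fin.tail x.1
      invFun := fun y => ⟨Fin.cons t y, by simp⟩
      left_inv := fun x => by
        apply Subtype.ext
        have hx : x.1 0 = t := x.2
        conv_rhs => rw [← Fin.cons_self_tail x.1]
        rw [hx]
      right_inv := fun y => by simp }
  rw [Fintype.card_congr e, Fintype.card_pi, Finset.prod_const, ZMod.card, Finset.card_univ,
    Fintype.card_fin]

/-- Fermionic indices over a site set `T`: `#{p // p.1 ∈ T} = |T| · N · 4`. -/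
theorem card_idx_mem {N : ℕ} (T : Finset (TorusSite 4 L)) :
    Fintype.card {p : TorusSite 4 L × Fin N × Fin 4 // p.1 ∈ T} = T.card * (N * 4) := by
  rw [Fintype.card_congr (Equiv.prodSubtypeFstEquivSubtypeProd (p := fun x : TorusSite 4 L => x ∈ T)),
    Fintype.card_prod, Fintype.card_coe, Fintype.card_prod, Fintype.card_fin, Fintype.card_fin]

/-- ... and the complementary count. -/
theorem card_idx_not_mem {N : ℕ} (T : Finset (TorusSite 4 L)) :
    Fintype.card {p : TorusSite 4 L × Fin N × Fin 4 // p.1 ∉ T} = L ^ 4 * (N * 4) - T.card * (N * 4) := by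
  rw [Fintype.card_subtype_compl, card_idx_mem]
  congr 1
  simp only [Fintype.card_prod, Fintype.card_fin, TorusSite, Fintype.card_pi, ZMod.card,
    Finset.prod_const, Finset.card_univ]

/-- The bonds of a slice have both endpoints in the slice. -/
theorem sliceBonds_support {t : ZMod L} {e : Edge 4 L} (he : e ∈ sliceBonds t) :
    e.1 ∈ sliceSites t ∧
      Literature.MathematicalPhysics.QuantumFieldTheory.Site.shift e.1 e.2 ∈ sliceSites t := by
  rw [mem_sliceBonds] at he
  refine ⟨by simpa using he.1, ?_⟩
  rw [mem_sliceSites, Literature.MathematicalPhysics.QuantumFieldTheory.Site.shift, Pi.add_apply,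
    Pi.single_apply, if_neg (Ne.symm he.2), add_zero, he.1]

/-- The bonds of a union of slices have both endpoints in the union of their sites. -/
theorem union_sliceBonds_support {t t' : ZMod L} {e : Edge 4 L}
    (he : e ∈ sliceBonds t ∪ sliceBonds t') :
    e.1 ∈ sliceSites t ∪ sliceSites t' ∧
      Literature.MathematicalPhysics.QuantumFieldTheory.Site.shift e.1 e.2 ∈
        sliceSites t ∪ sliceSites t' := by
  rcases Finset.mem_union.1 he with h | h
  · exact ⟨Finset.mem_union_left _ (sliceBonds_support h).1,
      Finset.mem_union_left _ (sliceBonds_support h).2⟩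
  · exact ⟨Finset.mem_union_right _ (sliceBonds_support h).1,
      Finset.mem_union_right _ (sliceBonds_support h).2⟩

/-- The bonds of a union of slices are spatial. -/
theorem union_sliceBonds_dir {t t' : ZMod L} {e : Edge 4 L} (he : e ∈ sliceBonds t ∪ sliceBonds t') :
    e.2 ∈ (univ : Finset (Fin 4)).erase 0 := by
  rcases Finset.mem_union.1 he with h | h <;> exact sliceBonds_dir h

end FloorA

/-! ## Floor assembly, part B: uniform pathwise bounds on the window, continuity, integrals -/

section FloorB

variable {L : ℕ} [NeZero L]

/-- **Uniform pathwise FLOOR on a mass window.** For `-1 < m_lo ≤ m ≤ m_hi`, a bond set `E` with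
spatial bonds supported in the site set `T`, and every `SU(3)` field:
`(c₁/C₂)^{12|T|} (m+4)^{12L⁴} ≤ Re det D_E^{AP}(U, m)` with `c₁ = m_lo + 1`, `C₂ = |m_lo| + |m_hi| + 8`. -/
theorem window_floor_re_det (E : Finset (Edge 4 L)) (T : Finset (TorusSite 4 L))
    (hdir : ∀ e ∈ E, e.2 ∈ (univ : Finset (Fin 4)).erase 0)
    (hT : ∀ e ∈ E, e.1 ∈ T ∧ Literature.MathematicalPhysics.QuantumFieldTheory.Site.shift e.1 e.2 ∈ T)
    {mlo mhi m : ℝ} (hmlo : -1 < mlo) (hm : mlo ≤ m ∧ m ≤ mhi)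
    (U : GaugeConfig 4 L (Matrix.specialUnitaryGroup (Fin 3) ℂ)) :
    ((mlo + 1) / (|mlo| + |mhi| + 8)) ^ (T.card * 12) * (m + 4) ^ (L ^ 4 * 12) ≤
      ((bondWilsonDiracAP E U m).det).re := by
  have hc1 : 0 < mlo + 1 := by linarith
  have hC2 : m + 4 ≤ |mlo| + |mhi| + 8 := by
    have := le_abs_self mhi; have := abs_nonneg mlo; linarith
  have hm4 : 3 < m + 4 := by linarith
  have hcard3 : (((univ : Finset (Fin 4)).erase 0).card : ℝ) < m + 4 := by
    rw [card_univ_erase_zero]; push_cast; linarith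
  have h := pow_mul_pow_le_re_det_bondWilsonDirac (unitaryFundamentalRep (Fin 3) ℂ)
    unitaryFundamentalRep_mem_unitaryGroup E (apLift U) _ hdir T hT hcard3
  rw [card_univ_erase_zero, card_idx_mem, card_idx_not_mem] at h
  refine le_trans ?_ h
  -- `(c₁/C₂)^A (m+4)^{A+B} ≤ (m+4-3)^A (m+4)^B`
  have hA : T.card * (3 * 4) ≤ L ^ 4 * (3 * 4) := by
    apply Nat.mul_le_mul_right
    calc T.card ≤ (univ : Finset (TorusSite 4 L)).card := Finset.card_le_univ _
      _ = L ^ 4 := by simp [TorusSite, Finset.card_univ, Fintype.card_pi, ZMod.card]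
  have hsplit : (m + 4) ^ (L ^ 4 * 12) = (m + 4) ^ (T.card * (3 * 4)) * (m + 4) ^ (L ^ 4 * (3 * 4) - T.card * (3 * 4)) := by
    rw [← pow_add, Nat.add_sub_cancel' hA]
  push_cast
  rw [show T.card * 12 = T.card * (3 * 4) by ring, hsplit, ← mul_assoc, ← mul_pow]
  apply mul_le_mul_of_nonneg_right _ (pow_nonneg (by linarith) _)
  apply pow_le_pow_left₀ (by positivity)
  rw [div_mul_eq_mul_div, div_le_iff₀ (by positivity)]
  have h1 : mlo + 1 ≤ m + 4 - 3 := by linarith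
  calc (mlo + 1) * (m + 4) ≤ (m + 4 - 3) * (|mlo| + |mhi| + 8) := by
        apply mul_le_mul h1 hC2 (by linarith) (by linarith)
    _ = (m + 4 - (3 : ℕ)) * (|mlo| + |mhi| + 8) := by push_cast; ring

/-- **Uniform pathwise CEILING on a mass window**:
`|det D_E^{AP}(U, m)| ≤ (C₂/3)^{12|T|} (m+4)^{12L⁴}`. -/
theorem window_ceiling_norm_det (E : Finset (Edge 4 L)) (T : Finset (TorusSite 4 L))
    (hdir : ∀ e ∈ E, e.2 ∈ (univ : Finset (Fin 4)).erase 0)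
    (hT : ∀ e ∈ E, e.1 ∈ T ∧ Literature.MathematicalPhysics.QuantumFieldTheory.Site.shift e.1 e.2 ∈ T)
    {mlo mhi m : ℝ} (hmlo : -1 < mlo) (hm : mlo ≤ m ∧ m ≤ mhi)
    (U : GaugeConfig 4 L (Matrix.specialUnitaryGroup (Fin 3) ℂ)) :
    ‖(bondWilsonDiracAP E U m).det‖ ≤
      ((|mlo| + |mhi| + 8) / 3) ^ (T.card * 12) * (m + 4) ^ (L ^ 4 * 12) := by
  have hm4 : 3 < m + 4 := by linarith
  have hC2 : m + 7 ≤ |mlo| + |mhi| + 8 := by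
    have := le_abs_self mhi; have := abs_nonneg mlo; linarith
  have h := norm_det_bondWilsonDirac_le_sharp (unitaryFundamentalRep (Fin 3) ℂ)
    unitaryFundamentalRep_mem_unitaryGroup E (apLift U) _ hdir T hT (by linarith : 0 < m + 4)
  rw [card_univ_erase_zero, card_idx_mem, card_idx_not_mem] at h
  refine h.trans ?_
  have hA : T.card * (3 * 4) ≤ L ^ 4 * (3 * 4) := by
    apply Nat.mul_le_mul_right
    calc T.card ≤ (univ : Finset (TorusSite 4 L)).card := Finset.card_le_univ _
      _ = L ^ 4 := by simp [TorusSite, Finset.card_univ, Fintype.card_pi, ZMod.card]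
  have hsplit : (m + 4) ^ (L ^ 4 * 12) =
      (m + 4) ^ (T.card * (3 * 4)) * (m + 4) ^ (L ^ 4 * (3 * 4) - T.card * (3 * 4)) := by
    rw [← pow_add, Nat.add_sub_cancel' hA]
  have hbase : |m + 4| + ((3 : ℕ) : ℝ) ≤ (|mlo| + |mhi| + 8) / 3 * (m + 4) := by
    rw [abs_of_pos (by linarith : 0 < m + 4), div_mul_eq_mul_div, le_div_iff₀ (by norm_num : (0:ℝ) < 3)]
    push_cast
    nlinarith [hC2, hm4]
  have hrest : 0 ≤ (m + 4) ^ (L ^ 4 * (3 * 4) - T.card * (3 * 4)) := pow_nonneg (by linarith) _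
  calc (|m + 4| + ((3 : ℕ) : ℝ)) ^ (T.card * (3 * 4)) * (m + 4) ^ (L ^ 4 * (3 * 4) - T.card * (3 * 4))
      ≤ ((|mlo| + |mhi| + 8) / 3 * (m + 4)) ^ (T.card * (3 * 4)) *
          (m + 4) ^ (L ^ 4 * (3 * 4) - T.card * (3 * 4)) := by
        apply mul_le_mul_of_nonneg_right _ hrest
        exact pow_le_pow_left₀ (by positivity) hbase _
    _ = ((|mlo| + |mhi| + 8) / 3) ^ (T.card * 12) * (m + 4) ^ (L ^ 4 * 12) := by
        rw [hsplit, mul_pow, show T.card * 12 = T.card * (3 * 4) by ring]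
        ring

end FloorB

/-! ## Floor assembly, part C: continuity and the diluted signed partition functions -/

section FloorC

open MeasureTheory

variable {L : ℕ} [NeZero L]

omit [NeZero L] in
/-- The diluted Wilson–Dirac matrix depends continuously on the gauge field. -/
theorem continuous_bondWilsonDirac {G : Type*} [Group G] [TopologicalSpace G] [IsTopologicalGroup G]
    {N : ℕ} (ρ : G →* Matrix (Fin N) (Fin N) ℂ) (hρ : Continuous ρ) (E : Finset (Edge 4 L)) (m r : ℝ) :
    Continuous fun U : GaugeConfig 4 L G => bondWilsonDirac ρ E U m r := by
  refine continuous_pi fun p => continuous_pi fun q => ?_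
  simp only [bondWilsonDirac, Matrix.of_apply]
  refine continuous_const.sub (continuous_const.mul (continuous_finsetSum _ fun μ _ => ?_))
  refine Continuous.add ?_ ?_
  · split_ifs
    · exact continuous_const.mul ((hρ.comp (continuous_apply _)).matrix_elem _ _)
    · exact continuous_const
  · split_ifs
    · exact continuous_const.mul ((hρ.comp ((continuous_apply _).inv)).matrix_elem _ _)
    · exact continuous_const

/-- `U ↦ det D_E^{AP}(U, m)` is continuous. -/
theorem continuous_det_bondWilsonDiracAP (E : Finset (Edge 4 L)) (m : ℝ) :
    Continuous fun U : GaugeConfig 4 L (Matrix.specialUnitaryGroup (Fin 3) ℂ) =>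
      (bondWilsonDiracAP E U m).det := by
  have hρ : Continuous (unitaryFundamentalRep (Fin 3) ℂ) := continuous_subtype_val
  have h := continuous_bondWilsonDirac (L := L) (unitaryFundamentalRep (Fin 3) ℂ) hρ E m 1
  have hfun : (fun U : GaugeConfig 4 L (Matrix.specialUnitaryGroup (Fin 3) ℂ) => bondWilsonDiracAP E U m) =
      (fun V => bondWilsonDirac (unitaryFundamentalRep (Fin 3) ℂ) E V m 1) ∘ apLift := by
    funext U; rfl
  have hc : Continuous fun U : GaugeConfig 4 L (Matrix.specialUnitaryGroup (Fin 3) ℂ) =>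
      bondWilsonDiracAP E U m := by
    rw [hfun]; exact h.comp UnquenchedChessboardBoundLine.continuous_apLift
  exact hc.matrix_det

/-- **The diluted signed partition function is a real integral** of the continuous function
`g_E(U) = (∏_f Re det D_E[U,m_f]) e^{-β S_W(U)}`: `Zb(E) = ↑(∫ g_E)`, with `g_E` integrable. -/
theorem signedZb_eq_ofReal (E : Finset (Edge 4 L)) (β : ℝ) {Nf : ℕ} (m : Fin Nf → ℝ) :
    let π : Measure (GaugeConfig 4 L (Matrix.specialUnitaryGroup (Fin 3) ℂ)) :=
      Measure.pi fun _ : Edge 4 L => haarProbability (Matrix.specialUnitaryGroup (Fin 3) ℂ)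
    let g : GaugeConfig 4 L (Matrix.specialUnitaryGroup (Fin 3) ℂ) → ℝ := fun U =>
      (∏ f, ((bondWilsonDiracAP E U (m f)).det).re) *
        Real.exp (-β * wilsonAction (fundamentalRep (Fin 3)) U)
    (∫ U, (∏ f, (bondWilsonDiracAP E U (m f)).det) *
        (Real.exp (-β * wilsonAction (fundamentalRep (Fin 3)) U) : ℂ) ∂π) = ((∫ U, g U ∂π : ℝ) : ℂ) ∧
      Integrable g π ∧ Continuous g := by
  intro π g
  have hreal : ∀ (U : GaugeConfig 4 L (Matrix.specialUnitaryGroup (Fin 3) ℂ)) (x : ℝ),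
      (bondWilsonDiracAP E U x).det = ((((bondWilsonDiracAP E U x).det).re : ℝ) : ℂ) :=
    fun U x => Complex.ext (by simp) (by simpa using det_bondWilsonDiracAP_im E U x)
  have hintegrand : ∀ U, (∏ f, (bondWilsonDiracAP E U (m f)).det) *
      (Real.exp (-β * wilsonAction (fundamentalRep (Fin 3)) U) : ℂ) = ((g U : ℝ) : ℂ) := by
    intro U
    simp only [g, Complex.ofReal_mul, Complex.ofReal_prod]
    congr 1
    exact Finset.prod_congr rfl fun f _ => hreal U (m f)
  have hgcont : Continuous g := by
    refine Continuous.mul (continuous_finsetProd _ fun f _ => ?_) ?_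
    · exact Complex.continuous_re.comp (continuous_det_bondWilsonDiracAP E (m f))
    · exact ((UnquenchedChessboardBoundLine.continuous_wilsonAction_su3 (L := L)).const_mul (-β)).rexp
  have hgi : Integrable g π := by
    haveI : SecondCountableTopology (Matrix (Fin 3) (Fin 3) ℂ) :=
      inferInstanceAs (SecondCountableTopology (Fin 3 → Fin 3 → ℂ))
    haveI : SecondCountableTopology (Matrix.specialUnitaryGroup (Fin 3) ℂ) :=
      Topology.IsEmbedding.subtypeVal.secondCountableTopology
    obtain ⟨U₀, -, hU₀⟩ := (isCompact_univ (X := GaugeConfig 4 L (Matrix.specialUnitaryGroup (Fin 3) ℂ))).exists_isMaxOn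
      Set.univ_nonempty hgcont.norm.continuousOn
    exact Integrable.of_bound hgcont.measurable.aestronglyMeasurable ‖g U₀‖
      (Filter.Eventually.of_forall fun U => hU₀ (Set.mem_univ U))
  refine ⟨?_, hgi, hgcont⟩
  rw [integral_congr_ae (ae_of_all _ hintegrand), integral_complex_ofReal]

end FloorC

/-! ## Floor assembly, part C′: the window bounds on the product over flavours -/

section FloorProd

variable {L : ℕ} [NeZero L]

/-- Pathwise FLOOR on the product over flavours:
`c^{12|T|N_f} ∏_f (m_f+4)^{12L⁴} ≤ ∏_f Re det D_E^{AP}(U, m_f)`. -/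
theorem window_floor_prod (E : Finset (Edge 4 L)) (T : Finset (TorusSite 4 L))
    (hdir : ∀ e ∈ E, e.2 ∈ (univ : Finset (Fin 4)).erase 0)
    (hT : ∀ e ∈ E, e.1 ∈ T ∧ Literature.MathematicalPhysics.QuantumFieldTheory.Site.shift e.1 e.2 ∈ T)
    {mlo mhi : ℝ} (hmlo : -1 < mlo) {Nf : ℕ} (m : Fin Nf → ℝ) (hm : ∀ f, mlo ≤ m f ∧ m f ≤ mhi)
    (U : GaugeConfig 4 L (Matrix.specialUnitaryGroup (Fin 3) ℂ)) :
    ((mlo + 1) / (|mlo| + |mhi| + 8)) ^ (T.card * 12 * Nf) * ∏ f, (m f + 4) ^ (L ^ 4 * 12) ≤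
      ∏ f, ((bondWilsonDiracAP E U (m f)).det).re := by
  have hL : ((mlo + 1) / (|mlo| + |mhi| + 8)) ^ (T.card * 12 * Nf) * ∏ f, (m f + 4) ^ (L ^ 4 * 12) =
      ∏ f : Fin Nf, (((mlo + 1) / (|mlo| + |mhi| + 8)) ^ (T.card * 12) * (m f + 4) ^ (L ^ 4 * 12)) := by
    rw [Finset.prod_mul_distrib, Finset.prod_const, Finset.card_univ, Fintype.card_fin, ← pow_mul]
  rw [hL]
  refine Finset.prod_le_prod (fun f _ => ?_) fun f _ => window_floor_re_det E T hdir hT hmlo (hm f) U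
  have : 0 < (mlo + 1) / (|mlo| + |mhi| + 8) := div_pos (by linarith) (by positivity)
  have : 0 < m f + 4 := by linarith [(hm f).1]
  positivity

/-- Pathwise CEILING on the product over flavours:
`∏_f Re det D_E^{AP}(U, m_f) ≤ Cc^{12|T|N_f} ∏_f (m_f+4)^{12L⁴}`. -/
theorem window_ceiling_prod (E : Finset (Edge 4 L)) (T : Finset (TorusSite 4 L))
    (hdir : ∀ e ∈ E, e.2 ∈ (univ : Finset (Fin 4)).erase 0)
    (hT : ∀ e ∈ E, e.1 ∈ T ∧ Literature.MathematicalPhysics.QuantumFieldTheory.Site.shift e.1 e.2 ∈ T)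
    {mlo mhi : ℝ} (hmlo : -1 < mlo) {Nf : ℕ} (m : Fin Nf → ℝ) (hm : ∀ f, mlo ≤ m f ∧ m f ≤ mhi)
    (U : GaugeConfig 4 L (Matrix.specialUnitaryGroup (Fin 3) ℂ)) :
    ∏ f, ((bondWilsonDiracAP E U (m f)).det).re ≤
      ((|mlo| + |mhi| + 8) / 3) ^ (T.card * 12 * Nf) * ∏ f, (m f + 4) ^ (L ^ 4 * 12) := by
  have hR : ((|mlo| + |mhi| + 8) / 3) ^ (T.card * 12 * Nf) * ∏ f, (m f + 4) ^ (L ^ 4 * 12) =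
      ∏ f : Fin Nf, (((|mlo| + |mhi| + 8) / 3) ^ (T.card * 12) * (m f + 4) ^ (L ^ 4 * 12)) := by
    rw [Finset.prod_mul_distrib, Finset.prod_const, Finset.card_univ, Fintype.card_fin, ← pow_mul]
  rw [hR]
  refine Finset.prod_le_prod (fun f _ => ?_) fun f _ => ?_
  · refine le_trans ?_ (window_floor_re_det E T hdir hT hmlo (hm f) U)
    have : 0 < (mlo + 1) / (|mlo| + |mhi| + 8) := div_pos (by linarith) (by positivity)
    have : 0 < m f + 4 := by linarith [(hm f).1]
    positivity
  · exact (Complex.re_le_norm _).trans (window_ceiling_norm_det E T hdir hT hmlo (hm f) U)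

end FloorProd


/-! ## Floor assembly, part C″: integrability, `Re Zb` as a real integral -/

section FloorInt

open MeasureTheory

variable {L : ℕ} [NeZero L]

/-- Continuous real functions of the `SU(3)` gauge field are integrable for the product Haar
probability measure (compactness). -/
theorem integrable_of_continuous_su3 (g : GaugeConfig 4 L (Matrix.specialUnitaryGroup (Fin 3) ℂ) → ℝ)
    (hg : Continuous g) :
    Integrable g (Measure.pi fun _ : Edge 4 L => haarProbability (Matrix.specialUnitaryGroup (Fin 3) ℂ)) := by
  haveI : SecondCountableTopology (Matrix (Fin 3) (Fin 3) ℂ) :=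
    inferInstanceAs (SecondCountableTopology (Fin 3 → Fin 3 → ℂ))
  haveI : SecondCountableTopology (Matrix.specialUnitaryGroup (Fin 3) ℂ) :=
    Topology.IsEmbedding.subtypeVal.secondCountableTopology
  obtain ⟨U₀, -, hU₀⟩ :=
    (isCompact_univ (X := GaugeConfig 4 L (Matrix.specialUnitaryGroup (Fin 3) ℂ))).exists_isMaxOn
      Set.univ_nonempty hg.norm.continuousOn
  exact Integrable.of_bound hg.measurable.aestronglyMeasurable ‖g U₀‖
    (Filter.Eventually.of_forall fun U => hU₀ (Set.mem_univ U))

/-- The real part of the diluted signed partition function as a real integral. -/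
theorem re_signedZb_eq (E : Finset (Edge 4 L)) (β : ℝ) {Nf : ℕ} (m : Fin Nf → ℝ) :
    (∫ U, (∏ f, (bondWilsonDiracAP E U (m f)).det) *
        (Real.exp (-β * wilsonAction (fundamentalRep (Fin 3)) U) : ℂ)
        ∂(Measure.pi fun _ : Edge 4 L => haarProbability (Matrix.specialUnitaryGroup (Fin 3) ℂ))).re =
      ∫ U, (∏ f, ((bondWilsonDiracAP E U (m f)).det).re) *
          Real.exp (-β * wilsonAction (fundamentalRep (Fin 3)) U)
        ∂(Measure.pi fun _ : Edge 4 L => haarProbability (Matrix.specialUnitaryGroup (Fin 3) ℂ)) := by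
  have h := (signedZb_eq_ofReal E β m).1
  rw [h, Complex.ofReal_re]

end FloorInt


end Summit.QuantumFields.QCD.Theorems.QuarksAsStableAction

end
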